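import Summits.BirchSwinnertonDyer.BirchSwinnertonDyer.Theorems.KimAtThreeTwoExponentEndProduct
import Summits.BirchSwinnertonDyer.BirchSwinnertonDyer.Theorems.KimAtThreeKolyvaginDeepLowerKatoStratumShallow
import HarnessLib

/-!
# Route `KimAtThreeKolyvagin` (rung W2), crux `ShallowEqDeepOffKatoStratum` (19599), stub `stub_additiveDefect`:
# the two-exponent Cor C-t at every depth from the tower, any certificate, and the ALL-LEVELS inequality
# `∂⁽⁰⁾ ≤ ord₃ #Ш(3) + ∂^{(∞)}` on the additive-defect rows GRANTED the two-exponent port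

Cell `bsd-addord`, seat `bsd-addord-w2-acc6` (PROGRAMME PART 1b, plan g16 ACCEL-LIST (6)); `--supports` 19599.
HONEST FRAMING. TOOL theorems only: no definition, no named fact, no `sorry`; nothing asserted, nothing booked, no
mark moved; crux 19599 (and 19562 / 19679) stay OPEN.  CONDITIONAL exactly as kim3's Kato-stratum chain
(`KimAtThreeKolyvaginDeepLowerNestedEnd` / `…DeepLowerKatoStratum` / `…DeepLowerKatoStratumShallow`) EXCEPT that
the `P`-keyed two-level dictionary / the port is the TWO-EXPONENT one of `KimAtThreeKolyvaginDefs`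
(`KatoKuriharaDictionaryThreeAt₂AtTwoExp` / `KatoKuriharaPortThreeAtWith₂TwoExp`, FLAG `K22-Thm3.13-PORT@3`, value law
`3^e · Λ(loc κ_d) = u · 3^t · δ̃_{n(d)}`; ANY `e`), the row binders `3 ∤ c₃`, `3 ∤ c_P` and the `3`-adic period
transfer are GONE (they fail on the additive-defect rows: Kodaira IV/IV*, `3 ∣` Manin constant), and every
conclusion is read on the newform's own plus symbol `[0]⁺_{P.f} = δ̃_1` (no `Ω(W)`).  The exponent `e` cancels in the
bottom assembly `KimAtThreeTwoExponentAssembly.pow_dvd_natCard_selmerGroup_of_certificate_twoExp`; every theorem here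
is the corresponding kim3 / n1011 theorem with ONE binder re-typed and the same proof text (credit kim3 gen 8,
cell b2b-bsdres n1011-p18/p03/p11; adapted, not edited).

* `padicValRat_ratPlusSymbol_le_of_towerSurj_twoExp_with_depth` — twin of kim3's
  `…DeepLowerKatoStratum.exists_LOmega_padicValRat_le_of_towerSurj_with_depth`: every binder of the END theorem
  discharged from the `3`-adic tower ([S24] (1)(2), GZK, Poitou–Tate families, the shared-`η` tower family), ONE port
  `KatoKuriharaPortThreeAtWith₂TwoExp W 0 e v₃ η D`;
* `padicValRat_ratPlusSymbol_le_of_towerSurj_twoExp_of_anyCertificate` — minimality removed;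
* **`kuriharaPartial_zero_le_sha_add_partialInfty_of_portTwoExp`** — on an additive-DEFECT row at `t = 0`
  (Kodaira IV/IV* or `3 ∣ c_D`, datum at the conductor, `ord(δ̃) = 0`): `∂⁽⁰⁾(δ̃) ≤ ord₃ #Ш(3) + ∂^{(∞)}(δ̃)`
  (ALL levels) — the hypothesis `hdiv` of w2-c4 g5's socket
  `KimAtThreeShallowEqDeepOffStratumSockets.shallowEqDeep_conclusion_of_upperRow_of_le_add_partialInfty`.
  «Shallow and deep vanishing orders shift by the same `v₃(c₃)`» (plan g16 ACCEL-LIST (6)): the defect shifts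
  nothing in this inequality.
References: [Kim2022StructureSelmer] Thm. 1.9 (6), Thm. 3.13, §3.2.3, Rem. 3.7, Lemma 3.9; [Kim2025RefinedTNC] Thm 1.1,
Thm 1.2, §8.1.2; [Sakamoto2024] Thm. 4.4; [MazurRubin2004] Thm. 3.2.4, 4.4.1, 5.2.12, App. A (33);
[Kato2004Asterisque] Thm. 12.5 (1); [MilneADT2006] I Thm. 4.10; cell memo
`run/shared/lean/pub/bsd-addord/kim3/KIM3-PROOF.md` §4.4, Lemma L/L′, §16 (Cor C-t).
-/

set_option autoImplicit false
-- the Theorems namespace of a single-conjunct summit repeats the summit name by design (D-0017)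
set_option linter.dupNamespace false

noncomputable section

open scoped Classical NumberField ContRepresentation
open Function Field NumberField IsDedekindDomain IsDedekindDomain.HeightOneSpectrum WeierstrassCurve
  CongruenceSubgroup
  Literature.NumberTheory.EllipticCurves Literature.NumberTheory.EllipticCurves.ModularForms
  Literature.NumberTheory.EllipticCurves.Rank1Residual
  Literature.NumberTheory.GaloisRepresentations
  Literature.NumberTheory.GaloisRepresentations.DiscreteGaloisModule Literature.NumberTheory.GaloisCohomology
  Rat.HeightOneSpectrum
  Summit.BirchSwinnertonDyer.Rank1Residual.GaloisImage
  Summit.BirchSwinnertonDyer.Rank1Residual.GaloisImage.Assembly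
  Summit.BirchSwinnertonDyer.Rank1Residual.X4

namespace Summit.BirchSwinnertonDyer.BirchSwinnertonDyer.Theorems.KimAtThreeTwoExponentTower

open Summit.BirchSwinnertonDyer.BirchSwinnertonDyer.Theorems.KimAtThreeKolyvaginDefs
  Summit.BirchSwinnertonDyer.BirchSwinnertonDyer.Theorems.KimAtThreeTwoExponentEndProduct
  Summit.BirchSwinnertonDyer.BirchSwinnertonDyer.Theorems.KimAtThreeKolyvaginDeepLowerKatoStratum
  Summit.BirchSwinnertonDyer.BirchSwinnertonDyer.Theorems.KimAtThreeKolyvaginUnitLevelOneRungs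
  Summit.BirchSwinnertonDyer.BirchSwinnertonDyer.Theorems.KimAtThreeKolyvaginCertificateDictionary

/-- **Cor C-t at `t = 0`, every depth, TWO-EXPONENT form, `[0]⁺_f`-currency** — twin of kim3's
`KimAtThreeKolyvaginDeepLowerKatoStratum.exists_LOmega_padicValRat_le_of_towerSurj_with_depth`: `W/ℚ` globally
minimal, ADDITIVE at `3` (ANY `c₃`), the `3`-adic tower onto, `E(ℚ₃)[3] = 0`, a datum `D` with `[0]⁺_{D.f} ≠ 0`
(ANY Manin constant, NO period transfer); `hS24`/`hS24₂`, GZK, the Poitou–Tate families; ONE port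
`KatoKuriharaPortThreeAtWith₂TwoExp W 0 e v₃ η D` (any `e`); a certificate at a cyclic `n ∈ 𝒩_{k+1}(E,3)`
(`ℓ ∤ N`, `ψ ↠ ℤ/3^j`, `δ̃^{(j)}_n(ψ) ≠ 0`, minimal) ⟹ `ord₃ [0]⁺_{D.f} ≤ ord₃ #Ш(E)(3) + (j − 1)`.  Proof =
kim3's (admissible `T`, the shared-`η` tower family `TowerPackage.exists_towerFamily_with`, nesting above `k`),
the port unpacked inline, ending in `padicValRat_ratPlusSymbol_le_of_kolyvaginProduct_of_card_torsion_le_nested_twoExp`.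
[cite: Kim2022StructureSelmer, Thm. 1.9 (6) and Thm. 3.13] [cite: Sakamoto2024, Thm. 4.4 (p. 926)]
[cite: MilneADT2006, I §2 Thm 2.8 (p. 31)] -/
theorem padicValRat_ratPlusSymbol_le_of_towerSurj_twoExp_with_depth
    (hS24 : Sakamoto2024.kolyvaginSystems_freeRankOne_zmod_three_pow)
    (hS24₂ : Sakamoto2024.kolyvaginSystems_idealOfBasis_eq_fittingIdeal_zmod_three_pow)
    (hGZK : rank_eq_analyticRank_of_analyticRank_le_one)
    (W : WeierstrassCurve ℚ) [W.IsElliptic] [W.IsGloballyMinimal]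
    -- the row
    (hadd : haveI : Fact (Nat.Prime 3) := ⟨Nat.prime_three⟩; Addv W 3)
    (htower : ∀ m : ℕ, W.HasSurjectiveModNGaloisRep (3 ^ m : ℕ))
    (ht0 : Nat.card {Q : (W.baseChange ℚ_[3]).toAffine.Point // (3 : ℕ) • Q = 0} = 1)
    {N : ℕ} [NeZero N] (D : ModularParametrizationData W N) (h0 : ratPlusSymbol D.f 0 ≠ 0) (e : ℕ)
    -- the Poitou–Tate families
    (inv : LocalInvariants ℚ 3) (hperf : inv.IsPerfect) (hsum : inv.SumLocalTermEqZero)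
    (hcompl : inv.SelmerComplement)
    (inv' : ∀ k' : ℕ, LocalInvariants ℚ (3 ^ (k' + 1))) (hperf' : ∀ k', (inv' k').IsPerfect)
    (hsum' : ∀ k', (inv' k').SumLocalTermEqZero) (hcompl' : ∀ k', (inv' k').SelmerComplement)
    (hinj' : ∀ k', ∀ v : HeightOneSpectrum (𝓞 ℚ), Injective (inv' k' (Sum.inr v)))
    -- ONE port: the TWO-EXPONENT shared-generator closure at `D` (exponent `e`)
    (v₃ : HeightOneSpectrum (𝓞 ℚ)) (hv₃ : ((3 : ℕ) : 𝓞 ℚ) ∈ v₃.asIdeal)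
    (η : (q : HeightOneSpectrum (𝓞 ℚ)) → (ZMod (Ideal.absNorm q.asIdeal))ˣ)
    (hη : ∀ q : HeightOneSpectrum (𝓞 ℚ), Subgroup.zpowers (η q) = ⊤)
    (hPort : KatoKuriharaPortThreeAtWith₂TwoExp W 0 e v₃ η D)
    -- the certificate: shallow depth `k`, modulus `3^j`
    (k : ℕ) (n : ℕ) [NeZero n] (hn : Kato.IsKolyvaginProduct W 3 (k + 1) n)
    (hcyc : ∀ (ℓ : ℕ) [Fact ℓ.Prime], ℓ ∣ n →
      Nat.card {P : ((integralModelInt W).map (Int.castRingHom (ZMod ℓ))).toAffine.Point //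
        3 • P = 0} ≤ 3)
    (hnN : ∀ ℓ ∈ n.primeFactors, ¬ ℓ ∣ N) {j : ℕ} (hjk : j ≤ k + 1)
    (ψ : (ℓ : ℕ) → (ZMod ℓ)ˣ →* Multiplicative (ZMod (3 ^ j)))
    (hψ : ∀ ℓ ∈ n.primeFactors, Function.Surjective (ψ ℓ))
    (hcert : kuriharaNumber D.f (3 ^ j) n ψ ≠ 0)
    (hv : ∀ d : ℕ, d ∣ n → 1 < d → d < n → ∀ [NeZero d], kuriharaNumber D.f (3 ^ j) d ψ = 0) :
    padicValRat 3 (ratPlusSymbol D.f 0) ≤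
      (padicValNat 3 (Nat.card (AddCommGroup.primaryComponent W.sha 3)) : ℤ) + ((j - 1 : ℕ) : ℤ) := by
  haveI : Fact (Nat.Prime 3) := ⟨Nat.prime_three⟩
  have hL : W.entireLFunction 1 ≠ 0 := D.isNewformOf.entireLFunction_one_ne_zero_of_ratPlusSymbol_zero_ne_zero h0
  -- the row: analytic rank `0`, `E(ℚ)` and `Ш` finite, surjectivity at `3` and at `3^{k+1}`
  have hr : W.analyticRank = 0 := analyticRank_eq_zero_of_entireLFunction_one_ne_zero W hL
  have hGZ := hGZK W (by rw [hr]; exact zero_le_one)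
  haveI : Finite W.sha := hGZ.2
  haveI : Finite W.toAffine.Point := W.mordellWeilRank_eq_zero_iff_holds.mp (by rw [hGZ.1, hr])
  have hsurj : W.HasSurjectiveModNGaloisRep ((3 : ℕ) : ℤ) := by simpa using htower 1
  have hsurjK : W.HasSurjectiveModNGaloisRep (((3 : ℕ) : ℤ) ^ k * ((3 : ℕ) : ℤ)) := by
    simpa only [Nat.cast_pow, Nat.cast_mul, pow_succ] using htower (k + 1)
  -- Tate's local Euler–Poincaré characteristic, by name (proved in the tree)
  have hEP : ∀ v : HeightOneSpectrum (𝓞 ℚ), localEulerPoincareCharacteristic (v.adicCompletion ℚ) :=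
    localEulerPoincareCharacteristic_rat
  -- the admissible set `T = {v ∣ 3} ∪ {bad}` and `S = S(T)`
  obtain ⟨T, h3T, hbadT, hTmem, hT, h𝓕T, h𝓚T, hfinT, hfinS⟩ := TowerPackage.towerAdmissible W
  have hS : ∀ w : InfinitePlace ℚ, (Sum.inl w : Place ℚ) ∈ finSupport T := inl_mem_finSupport T
  have h3S : ∀ v : HeightOneSpectrum (𝓞 ℚ), ((3 : ℕ) : 𝓞 ℚ) ∈ v.asIdeal →
      (Sum.inr v : Place ℚ) ∈ finSupport T := fun v hv => (inr_mem_finSupport_iff T v).mpr (h3T v hv)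
  have hbadS : ∀ v : HeightOneSpectrum (𝓞 ℚ), ¬ W.HasGoodReductionAt v →
      (Sum.inr v : Place ℚ) ∈ finSupport T := fun v hv => (inr_mem_finSupport_iff T v).mpr (hbadT v hv)
  have hSgood : ∀ v ∉ {v : HeightOneSpectrum (𝓞 ℚ) | (Sum.inr v : Place ℚ) ∈ finSupport T},
      W.HasGoodReductionAt v ∧ ((3 : ℕ) : 𝓞 ℚ) ∉ v.asIdeal := fun v hv =>
    ⟨by_contra fun h => hv (hbadS v h), fun h => hv (h3S v h)⟩
  have hSmem : ∀ v ∈ {v : HeightOneSpectrum (𝓞 ℚ) | (Sum.inr v : Place ℚ) ∈ finSupport T},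
      ¬ W.HasGoodReductionAt v ∨ ((3 : ℕ) : 𝓞 ℚ) ∈ v.asIdeal := fun v hv =>
    hTmem v ((inr_mem_finSupport_iff T v).mp hv)
  -- the shared-`η` tower family (pinned at every depth) and the reduction maps to depth `k`
  obtain ⟨τ, D', g', hτμ, hτq, hP', hDT', hD', hg', hgo', hgen', hR22', hUT', hPS', -⟩ :=
    TowerPackage.exists_towerFamily_with W hS24 hS24₂ htower inv hperf hsum hcompl hEP (finSupport T) hS
      h3S hbadS η hη
  choose red hred using fun k' => exists_torsionReduction_three W k k'
  -- every member passes the With-guard; the port unpacks at shallow depth `k`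
  have hDk : ∀ k', (D' k').IsCanonicalTauDatumThreeAtWith W (k' + 0) k' η := fun k' =>
    isCanonicalTauDatumThreeAtWith_of_primes_eq hSgood (hτμ k') (hτq k') (hP' k') (hDT' k') (hD' k')
  have hdict : ∀ k', k ≤ k' →
      KatoKuriharaDictionaryThreeAt₂AtTwoExp W 0 e k k' (D' k) (D' k') (red k') v₃ D := fun k' _ =>
    hPort k k' (D' k) (D' k') (red k') (hDk k) (hDk k')
  -- nesting ABOVE `k`: deeper pinned classes are smaller (class independence under the tower)
  have hPPk : ∀ k', k ≤ k' → (D' k').primes ⊆ (D' k).primes := fun k' hk' => by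
    rw [hP' k', hP' k]
    exact FrobShape.frobeniusClassPrimes_pow_mul_subset_of_le W 3 hk' hsurjK (hτμ k) (hτq k) (hτμ k')
      (hτq k') _
  -- the nested-only END at `(t, k, j) = (0, k, j)` with shallow datum `D′ k`
  exact padicValRat_ratPlusSymbol_le_of_kolyvaginProduct_of_card_torsion_le_nested_twoExp W 0 e k (D' k)
    v₃ hv₃ hadd hsurj (by rw [ht0, pow_zero]) D h0 (hDT' k) (g' k) (hg' k) (hgen' k) D' hDT'
    hPPk red hred hdict g' hg' hgo' hgen' inv' hperf' hsum' hcompl' hinj' hEP (fun _ => T)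
    (fun _ => h3T v₃ hv₃) hT h𝓕T h𝓚T hfinT hfinS
    (fun q hq => fun h => hPS' k q hq ((inr_mem_finSupport_iff T q).mpr h))
    (fun k' q hq => fun h => hPS' k' q hq ((inr_mem_finSupport_iff T q).mpr h))
    (hUT' k) hUT'
    (fun d hd => hR22' k (inv' k) (hperf' k) (hsum' k) (hcompl' k) d hd)
    (fun k' d hd => hR22' k' (inv' k') (hperf' k') (hsum' k') (hcompl' k') d hd)
    hSmem (hτμ k) (hτq k) (hP' k) hsurjK n hn hcyc hnN (j := j) (by simpa using hjk) ψ hψ hcert hv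

/-- **The same with an ARBITRARY certificate** (no vanishing at the proper sub-levels): descent to the least
certified divisor, verbatim kim3's `…_of_anyCertificate`. [cite: Kim2022StructureSelmer, Thm. 1.9 (6), §1.2.2 and §1.4.3]
[cite: Sakamoto2024, Thm. 4.4 (p. 926)] -/
theorem padicValRat_ratPlusSymbol_le_of_towerSurj_twoExp_of_anyCertificate
    (hS24 : Sakamoto2024.kolyvaginSystems_freeRankOne_zmod_three_pow)
    (hS24₂ : Sakamoto2024.kolyvaginSystems_idealOfBasis_eq_fittingIdeal_zmod_three_pow)
    (hGZK : rank_eq_analyticRank_of_analyticRank_le_one)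
    (W : WeierstrassCurve ℚ) [W.IsElliptic] [W.IsGloballyMinimal]
    (hadd : haveI : Fact (Nat.Prime 3) := ⟨Nat.prime_three⟩; Addv W 3)
    (htower : ∀ m : ℕ, W.HasSurjectiveModNGaloisRep (3 ^ m : ℕ))
    (ht0 : Nat.card {Q : (W.baseChange ℚ_[3]).toAffine.Point // (3 : ℕ) • Q = 0} = 1)
    {N : ℕ} [NeZero N] (D : ModularParametrizationData W N) (h0 : ratPlusSymbol D.f 0 ≠ 0) (e : ℕ)
    (inv : LocalInvariants ℚ 3) (hperf : inv.IsPerfect) (hsum : inv.SumLocalTermEqZero)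
    (hcompl : inv.SelmerComplement)
    (inv' : ∀ k' : ℕ, LocalInvariants ℚ (3 ^ (k' + 1))) (hperf' : ∀ k', (inv' k').IsPerfect)
    (hsum' : ∀ k', (inv' k').SumLocalTermEqZero) (hcompl' : ∀ k', (inv' k').SelmerComplement)
    (hinj' : ∀ k', ∀ v : HeightOneSpectrum (𝓞 ℚ), Injective (inv' k' (Sum.inr v)))
    (v₃ : HeightOneSpectrum (𝓞 ℚ)) (hv₃ : ((3 : ℕ) : 𝓞 ℚ) ∈ v₃.asIdeal)
    (η : (q : HeightOneSpectrum (𝓞 ℚ)) → (ZMod (Ideal.absNorm q.asIdeal))ˣ)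
    (hη : ∀ q : HeightOneSpectrum (𝓞 ℚ), Subgroup.zpowers (η q) = ⊤)
    (hPort : KatoKuriharaPortThreeAtWith₂TwoExp W 0 e v₃ η D)
    (k : ℕ) (n : ℕ) [NeZero n] (hn : Kato.IsKolyvaginProduct W 3 (k + 1) n)
    (hcyc : ∀ (ℓ : ℕ) [Fact ℓ.Prime], ℓ ∣ n →
      Nat.card {P : ((integralModelInt W).map (Int.castRingHom (ZMod ℓ))).toAffine.Point //
        3 • P = 0} ≤ 3)
    (hnN : ∀ ℓ ∈ n.primeFactors, ¬ ℓ ∣ N) {j : ℕ} (hjk : j ≤ k + 1)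
    (ψ : (ℓ : ℕ) → (ZMod ℓ)ˣ →* Multiplicative (ZMod (3 ^ j)))
    (hψ : ∀ ℓ ∈ n.primeFactors, Function.Surjective (ψ ℓ))
    (hcert : kuriharaNumber D.f (3 ^ j) n ψ ≠ 0) :
    padicValRat 3 (ratPlusSymbol D.f 0) ≤
      (padicValNat 3 (Nat.card (AddCommGroup.primaryComponent W.sha 3)) : ℤ) + ((j - 1 : ℕ) : ℤ) := by
  have hn0 : n ≠ 0 := hn.ne_zero
  -- the certified divisors `> 1`
  let P : ℕ → Prop := fun d => ∃ _ : d ∣ n ∧ 1 < d,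
    (haveI : NeZero d := ⟨by omega⟩; kuriharaNumber D.f (3 ^ j) d ψ) ≠ 0
  by_cases h1 : n = 1
  · -- `n = 1`: no proper divisor `1 < d < n`
    subst h1
    exact padicValRat_ratPlusSymbol_le_of_towerSurj_twoExp_with_depth hS24 hS24₂ hGZK W hadd htower ht0 D h0 e
      inv hperf hsum hcompl inv' hperf' hsum' hcompl' hinj' v₃ hv₃ η hη hPort k 1 hn hcyc hnN hjk
      ψ hψ hcert (fun d hd h1d hdn => absurd (Nat.le_of_dvd one_pos hd) (by omega))
  · have h1n : 1 < n := by
      rcases Nat.lt_or_ge 1 n with h | h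
      · exact h
      · exact absurd (le_antisymm h (Nat.one_le_iff_ne_zero.mpr hn0)) h1
    have hP : ∃ d, P d := ⟨n, ⟨dvd_rfl, h1n⟩, hcert⟩
    set m := Nat.find hP with hm
    obtain ⟨⟨hmn, h1m⟩, hcm⟩ : P m := Nat.find_spec hP
    haveI : NeZero m := ⟨by omega⟩
    refine padicValRat_ratPlusSymbol_le_of_towerSurj_twoExp_with_depth hS24 hS24₂ hGZK W hadd htower ht0 D h0 e
      inv hperf hsum hcompl inv' hperf' hsum' hcompl' hinj' v₃ hv₃ η hη hPort k m (hn.of_dvd hmn)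
      (fun ℓ _ hℓ => hcyc ℓ (hℓ.trans hmn)) (fun ℓ hℓ => hnN ℓ (Nat.primeFactors_mono hmn hn0 hℓ)) hjk ψ
      (fun ℓ hℓ => hψ ℓ (Nat.primeFactors_mono hmn hn0 hℓ)) hcm (fun d hd h1d hdm => ?_)
    -- a proper divisor `1 < d < m` is a smaller divisor of `n`, hence uncertified
    intro _
    by_contra hne
    exact Nat.find_min hP (hm ▸ hdm) ⟨⟨hd.trans hmn, h1d⟩, hne⟩

/-- **`∂⁽⁰⁾ ≤ ord₃ #Ш(3) + ∂^{(∞)}(δ̃)` — ALL levels, shallow included — on an additive-DEFECT row at `t = 0`,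
GRANTED the two-exponent port** (the hypothesis `hdiv` of w2-c4 g5's socket
`KimAtThreeShallowEqDeepOffStratumSockets.shallowEqDeep_conclusion_of_upperRow_of_le_add_partialInfty`).  Row:
`3`-adic tower onto, ADDITIVE at `3` (any `c₃`: Kodaira IV/IV* included), `E(ℚ₃)[3] = 0`, datum `D` at the
conductor (ANY Manin constant, NO period transfer), `ord(δ̃) = 0`; inputs [S24] Thm. 4.4 (1)(2) (`hS24`/`hS24₂`,
PUB), GZK (PUB), the Poitou–Tate families, ONE port `KatoKuriharaPortThreeAtWith₂TwoExp W 0 e v₃ η D` (FLAG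
`K22-Thm3.13-PORT@3`, two-exponent form; `e = v₃(c₃) + v₃(c_D)` in print, ANY `e` here).  A cyclic level `n`
with `ord δ̃_n < a − s` would carry an explicit `δ̃^{(k′)}_n(ψ) ≠ 0` with `k′ ≤ a − s` and `n ∈ 𝒩_{k′}`; the
two-exponent Cor C-t at shallow depth `k′ − 1` gives `a ≤ s + k′ − 1` — contradiction.  So the additive defect
shifts NOTHING in the all-levels inequality: «shallow and deep vanishing orders shift by the same `v₃(c₃)`»
(plan g16 ACCEL-LIST (6)). [cite: Kim2025RefinedTNC, Thm 1.1 and §8.1.2] [cite: Kim2022StructureSelmer, Thm. 1.9 (6), §1.5.1]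
[cite: Sakamoto2024, Thm. 4.4 (p. 926)] -/
theorem kuriharaPartial_zero_le_sha_add_partialInfty_of_portTwoExp
    (hS24 : Sakamoto2024.kolyvaginSystems_freeRankOne_zmod_three_pow)
    (hS24₂ : Sakamoto2024.kolyvaginSystems_idealOfBasis_eq_fittingIdeal_zmod_three_pow)
    (hGZK : rank_eq_analyticRank_of_analyticRank_le_one)
    (W : WeierstrassCurve ℚ) [W.IsElliptic] [W.IsGloballyMinimal]
    (hadd : haveI : Fact (Nat.Prime 3) := ⟨Nat.prime_three⟩; Addv W 3)
    (htower : ∀ m : ℕ, W.HasSurjectiveModNGaloisRep (3 ^ m : ℕ))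
    (ht0 : Nat.card {Q : (W.baseChange ℚ_[3]).toAffine.Point // (3 : ℕ) • Q = 0} = 1)
    {N : ℕ} [NeZero N] (hN : N = W.conductorNorm ℤ) (D : ModularParametrizationData W N) (e : ℕ)
    (inv : LocalInvariants ℚ 3) (hperf : inv.IsPerfect) (hsum : inv.SumLocalTermEqZero)
    (hcompl : inv.SelmerComplement)
    (inv' : ∀ k' : ℕ, LocalInvariants ℚ (3 ^ (k' + 1))) (hperf' : ∀ k', (inv' k').IsPerfect)
    (hsum' : ∀ k', (inv' k').SumLocalTermEqZero) (hcompl' : ∀ k', (inv' k').SelmerComplement)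
    (hinj' : ∀ k', ∀ v : HeightOneSpectrum (𝓞 ℚ), Injective (inv' k' (Sum.inr v)))
    (v₃ : HeightOneSpectrum (𝓞 ℚ)) (hv₃ : ((3 : ℕ) : 𝓞 ℚ) ∈ v₃.asIdeal)
    (η : (q : HeightOneSpectrum (𝓞 ℚ)) → (ZMod (Ideal.absNorm q.asIdeal))ˣ)
    (hη : ∀ q : HeightOneSpectrum (𝓞 ℚ), Subgroup.zpowers (η q) = ⊤)
    (hPort : KatoKuriharaPortThreeAtWith₂TwoExp W 0 e v₃ η D)
    (hord : kuriharaVanishingOrder W 3 D.f = 0) :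
    kuriharaPartial W 3 D.f 0 ≤
      (padicValNat 3 (Nat.card (AddCommGroup.primaryComponent W.sha 3)) : ℕ∞) +
        kuriharaPartialInfty W 3 D.f := by
  haveI : Fact (Nat.Prime 3) := ⟨Nat.prime_three⟩
  set s := padicValNat 3 (Nat.card (AddCommGroup.primaryComponent W.sha 3)) with hs
  have hirr : W.HasIrreducibleModPGaloisRep 3 :=
    hasIrreducibleModPGaloisRep_of_hasSurjectiveModNGaloisRep W 3 (by simpa using htower 1)
  have h0 : ratPlusSymbol D.f 0 ≠ 0 :=
    ratPlusSymbol_zero_ne_zero_of_kuriharaVanishingOrder_eq_zero W 3 D.f hord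
  have hint0 : ¬ 3 ∣ (ratPlusSymbol D.f 0).den :=
    not_dvd_den_of_norm_ratCast_le_one
      (D.isNewformOf.norm_ratPlusSymbol_le_one (x := 0) (by norm_num) hirr (by simp))
  have hv0 : 0 ≤ padicValRat 3 (ratPlusSymbol D.f 0) := by
    rw [padicValRat, padicValNat.eq_zero_of_not_dvd hint0]
    simp
  -- `a = ∂⁽⁰⁾(δ̃) = ord₃ [0]⁺_{D.f}`
  set a : ℕ := (padicValRat 3 (ratPlusSymbol D.f 0)).toNat with hadef
  have haq : (a : ℤ) = padicValRat 3 (ratPlusSymbol D.f 0) := by rw [hadef, Int.toNat_of_nonneg hv0]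
  have ha : kuriharaPartial W 3 D.f 0 = (a : ℕ∞) := by
    rw [kuriharaPartial_zero, kuriharaDivIndex_one_eq W 3 D.f hint0 h0]
  rw [ha]
  -- it suffices that every cyclic level has `a − s ≤ ord δ̃_n`
  suffices h : ((a - s : ℕ) : ℕ∞) ≤ kuriharaPartialInfty W 3 D.f by
    calc (a : ℕ∞) ≤ ((s + (a - s) : ℕ) : ℕ∞) := by exact_mod_cast (by omega : a ≤ s + (a - s))
      _ = (s : ℕ∞) + ((a - s : ℕ) : ℕ∞) := by push_cast; rfl
      _ ≤ (s : ℕ∞) + kuriharaPartialInfty W 3 D.f := add_le_add le_rfl h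
  refine le_iInf fun i => le_iInf fun n => le_iInf fun hn => le_iInf fun _ => ?_
  rw [coe_le_kuriharaDivIndex_iff]
  by_contra hcert
  obtain ⟨k', hk'1, hk'le, hk', ψ, hψ, hne⟩ :=
    exists_kuriharaNumber_ne_zero_of_not_kuriharaDivisibleAt W 3 D.f hcert
  haveI : NeZero n := ⟨hk'.ne_zero⟩
  have hn' : Kato.IsKolyvaginProduct W 3 (k' - 1 + 1) n := by rwa [Nat.sub_add_cancel hk'1]
  have hle := padicValRat_ratPlusSymbol_le_of_towerSurj_twoExp_of_anyCertificate hS24 hS24₂ hGZK W hadd htower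
    ht0 D h0 e inv hperf hsum hcompl inv' hperf' hsum' hcompl' hinj' v₃ hv₃ η hη hPort (k' - 1) n hn'
    (fun ℓ _ hℓ => hn.2 ℓ hℓ) (fun ℓ hℓ hℓN => (hk'.2 ℓ hℓ).not_dvd_conductorNorm (hN ▸ hℓN)) (j := k')
    (by omega) ψ hψ hne
  rw [← haq] at hle
  have hle' : (a : ℤ) ≤ ((s + (k' - 1) : ℕ) : ℤ) := by push_cast at hle ⊢; linarith
  have h'' : a ≤ s + (k' - 1) := by exact_mod_cast hle'
  omega

end Summit.BirchSwinnertonDyer.BirchSwinnertonDyer.Theorems.KimAtThreeTwoExponentTower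

end
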